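import Summits.QuantumAdvantage.QuantumAdvantage.Theorems.CharDialTokenDialP1
import HarnessLib

/-!
# WalkHardFJLinOdd — the token dial, part R: row independence from the GEOMETRY of several far readers

Cell `decomp-qadv`, lens 6, generation 19 (REV4 «FarFlipDial», geometry supplement).  The far dial's hypothesis `IndepRows t far L`
(part N2: every nonzero `ZMod 3`-combination of the address row of `t` and of the gap rows of the far readers has at least `L` nonzero
coordinates) holds as soon as the MARKS `t, g₁, …, g_m` are pairwise at distance `≥ L` and at least `L` positions lie outside their hull
(★ `indepRows_of_separated`; part P1's `indepRows_single` is the case `m = 1`).  Proof: with a nonzero address coefficient the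
combination is `±` the address row outside the hull; otherwise take the far reader with nonzero coefficient that is outermost on its side
of `t` — on the `L` coordinates just inside it the combination equals that coefficient.  Hence the far dial in purely METRIC form:
`TowerDefs.SepFlipHyp p K w L y` (reacting cuts = at most `K` far readers pairwise and from the pair `≥ L` apart with `≥ L` positions
outside their hull, plus cuts within `w` of the pair; `#flipAny ≥ 2ⁿ/(4p)`) implies `FarFlipHyp p K w L y`, and ★ `sepFlip_hard_log`:
at `K = w = dialB n`, `L = farL n = (log₂ n)³` such strategies win on at most `(1 − 1/(48p))·2ⁿ` inputs, eventually.
-/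

set_option autoImplicit false

open Finset

namespace Summit.QuantumAdvantage.AdviceFreeQNC0.JLinPeel.TokenDial

open SegMove

variable {n m : ℕ}

section Geometry

/-- the rows, unfolded. -/
theorem rowsF_zero (t : Fin n) (far : Fin m → Fin (n + 1)) : rowsF t far 0 = rowA t.val := rfl

/-- the rows, unfolded. -/
theorem rowsF_succ (t : Fin n) (far : Fin m → Fin (n + 1)) (k : Fin m) :
    rowsF t far k.succ = rowG (min (far k).val t.val) (max (far k).val t.val) := rfl

/-- the combination, unfolded: address term plus the gap terms. -/
theorem combW_rowsF (μ : Fin (m + 1) → ZMod 3) (t : Fin n) (far : Fin m → Fin (n + 1)) (i : Fin n) :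
    combW μ (rowsF t far) i = μ 0 * rowA t.val i + ∑ k : Fin m, μ k.succ * rowG (min (far k).val t.val) (max (far k).val t.val) i := by
  unfold combW
  rw [Fin.sum_univ_succ]
  rfl

/-- the address row never vanishes. -/
theorem rowA_ne_zero (t : ℕ) (i : Fin n) : rowA t i ≠ 0 := by
  unfold rowA; split_ifs <;> decide

/-- the gap row of a RIGHT reader (`t ≤ g`) at coordinate `i`: `[t ≤ i < g]`. -/
theorem rowG_right {t g : ℕ} (htg : t ≤ g) (i : Fin n) :
    rowG (min g t) (max g t) i = if t ≤ i.val ∧ i.val < g then 1 else 0 := by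
  rw [min_eq_right htg, max_eq_left htg]; rfl

/-- the gap row of a LEFT reader (`g ≤ t`) at coordinate `i`: `[g ≤ i < t]`. -/
theorem rowG_left {t g : ℕ} (hgt : g ≤ t) (i : Fin n) :
    rowG (min g t) (max g t) i = if g ≤ i.val ∧ i.val < t then 1 else 0 := by
  rw [min_eq_left hgt, max_eq_right hgt]; rfl

/-- ★ **row independence from separated marks.** if every far reader is at distance `≥ L` from `t`, the far readers are pairwise at
distance `≥ L`, and at least `L` positions lie outside the hull of the marks (left of all of them, or at/after all of them), then
`IndepRows t far L`. -/
theorem indepRows_of_separated (t : Fin n) (far : Fin m → Fin (n + 1)) (L : ℕ)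
    (hsepT : ∀ k, (far k).val + L ≤ t.val ∨ t.val + L ≤ (far k).val)
    (hsep : ∀ k k', k ≠ k' → (far k).val + L ≤ (far k').val ∨ (far k').val + L ≤ (far k).val)
    (hout : L ≤ (univ.filter fun i : Fin n =>
      (i.val < t.val ∧ ∀ k, i.val < (far k).val) ∨ (t.val ≤ i.val ∧ ∀ k, (far k).val ≤ i.val)).card) :
    IndepRows t far L := by
  classical
  rcases Nat.eq_zero_or_pos L with hL0 | hL1
  · intro μ _; rw [hL0]; exact Nat.zero_le _
  haveI : Fact (Nat.Prime 3) := ⟨Nat.prime_three⟩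
  intro μ hμ
  by_cases h0 : μ 0 = 0
  swap
  · -- (A) nonzero address coefficient: the combination is `μ₀·rowA ≠ 0` outside the hull
    refine le_trans hout (card_le_card fun i hi => ?_)
    rw [mem_filter] at hi ⊢
    refine ⟨mem_univ _, ?_⟩
    have hg : ∀ k, rowG (min (far k).val t.val) (max (far k).val t.val) i = 0 := by
      intro k
      rcases hsepT k with hl | hr
      · rw [rowG_left (by omega)]
        rcases hi.2 with ⟨h1, h2⟩ | ⟨h1, h2⟩
        · have := h2 k; rw [if_neg (by omega)]
        · rw [if_neg (by omega)]
      · rw [rowG_right (by omega)]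
        rcases hi.2 with ⟨h1, h2⟩ | ⟨h1, h2⟩
        · rw [if_neg (by omega)]
        · have := h2 k; rw [if_neg (by omega)]
    rw [combW_rowsF, sum_eq_zero (fun k _ => by rw [hg k, mul_zero]), add_zero]
    exact mul_ne_zero h0 (rowA_ne_zero _ _)
  · -- (B) μ₀ = 0: some gap coefficient is nonzero
    have hex : ∃ k : Fin m, μ k.succ ≠ 0 := by
      by_contra hno
      push Not at hno
      exact hμ (funext fun j => Fin.cases h0 hno j)
    have hval : ∀ i : Fin n, combW μ (rowsF t far) i =
        ∑ k : Fin m, μ k.succ * rowG (min (far k).val t.val) (max (far k).val t.val) i := by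
      intro i; rw [combW_rowsF, h0, zero_mul, zero_add]
    by_cases hR : ∃ k : Fin m, t.val + L ≤ (far k).val ∧ μ k.succ ≠ 0
    · -- (B1) an active RIGHT reader: take the outermost one
      set S : Finset (Fin m) := univ.filter fun k => t.val + L ≤ (far k).val ∧ μ k.succ ≠ 0 with hS
      have hSne : S.Nonempty := by
        obtain ⟨k, hk⟩ := hR
        exact ⟨k, by rw [hS, mem_filter]; exact ⟨mem_univ _, hk⟩⟩
      obtain ⟨ks, hks, hmax⟩ := exists_max_image S (fun k => (far k).val) hSne
      rw [hS, mem_filter] at hks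
      obtain ⟨-, hksR, hksμ⟩ := hks
      set G := (far ks).val with hG
      have hGn : G ≤ n := by have := (far ks).isLt; omega
      -- on `[G − L, G)` the combination is `μ ks`
      have hwin : (univ.filter fun i : Fin n => G - L ≤ i.val ∧ i.val < G)
          ⊆ univ.filter fun i : Fin n => ¬ combW μ (rowsF t far) i = 0 := by
        intro i hi
        rw [mem_filter] at hi ⊢
        refine ⟨mem_univ _, ?_⟩
        obtain ⟨-, hi1, hi2⟩ := hi
        rw [hval i, sum_eq_single ks]
        · rw [rowG_right (show t.val ≤ G by omega), if_pos (by constructor <;> omega), mul_one]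
          exact hksμ
        · intro k _ hk
          rcases hsepT k with hl | hr
          · rw [rowG_left (by omega), if_neg (by omega), mul_zero]
          · rcases hsep k ks hk with h1 | h2
            · rw [rowG_right (by omega), if_neg (by omega), mul_zero]
            · -- a right reader beyond `G`: inactive by maximality
              by_cases hμk : μ k.succ = 0
              · rw [hμk, zero_mul]
              · exfalso
                have hkS : k ∈ S := by rw [hS, mem_filter]; exact ⟨mem_univ _, by omega, hμk⟩
                have := hmax k hkS
                omega
        · intro h; exact absurd (mem_univ _) h
      have hc := card_le_card hwin
      rw [card_window hGn] at hc
      omega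
    · -- (B2) no active right reader: an active LEFT reader, take the outermost one
      push Not at hR
      obtain ⟨k₀, hk₀⟩ := hex
      have hk₀L : (far k₀).val + L ≤ t.val := by
        rcases hsepT k₀ with h | h
        · exact h
        · exact absurd (hR k₀ h) hk₀
      set S : Finset (Fin m) := univ.filter fun k => (far k).val + L ≤ t.val ∧ μ k.succ ≠ 0 with hS
      have hSne : S.Nonempty := ⟨k₀, by rw [hS, mem_filter]; exact ⟨mem_univ _, hk₀L, hk₀⟩⟩
      obtain ⟨ks, hks, hmin⟩ := exists_min_image S (fun k => (far k).val) hSne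
      rw [hS, mem_filter] at hks
      obtain ⟨-, hksL, hksμ⟩ := hks
      set G := (far ks).val with hG
      have hGn : G + L ≤ n := by have := t.isLt; omega
      -- on `[G, G + L)` the combination is `μ ks`
      have hwin : (univ.filter fun i : Fin n => G ≤ i.val ∧ i.val < G + L)
          ⊆ univ.filter fun i : Fin n => ¬ combW μ (rowsF t far) i = 0 := by
        intro i hi
        rw [mem_filter] at hi ⊢
        refine ⟨mem_univ _, ?_⟩
        obtain ⟨-, hi1, hi2⟩ := hi
        rw [hval i, sum_eq_single ks]
        · rw [rowG_left (show G ≤ t.val by omega), if_pos (by constructor <;> omega), mul_one]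
          exact hksμ
        · intro k _ hk
          rcases hsepT k with hl | hr
          · rcases hsep k ks hk with h1 | h2
            · -- a left reader before `G`: inactive by minimality
              by_cases hμk : μ k.succ = 0
              · rw [hμk, zero_mul]
              · exfalso
                have hkS : k ∈ S := by rw [hS, mem_filter]; exact ⟨mem_univ _, hl, hμk⟩
                have := hmin k hkS
                omega
            · rw [rowG_left (by omega), if_neg (by omega), mul_zero]
          · rw [rowG_right (by omega), if_neg (by omega), mul_zero]
        · intro h; exact absurd (mem_univ _) h
      have hc := card_le_card hwin
      rw [card_window hGn] at hc
      omega

end Geometry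

end Summit.QuantumAdvantage.AdviceFreeQNC0.JLinPeel.TokenDial

namespace Summit.QuantumAdvantage.AdviceFreeQNC0.JLinPeel.TowerDefs

variable {n : ℕ}

/-- **the SEPARATED-READER FLIP DIAL hypothesis** (the far dial in metric form): an adjacent pair `(s, t = s+1)`, a set `R` of at most
`K` cuts outside which every cut is swap-stable, among them at most `K` FAR READERS each at distance `≥ L` from `t`, pairwise at distance
`≥ L`, with `≥ L` positions outside the hull of `t` and the far readers, every other cut of `R` within `w` of `t`, and `#flipAny ≥ 2ⁿ/(4p)`. -/
def SepFlipHyp (p K w L : ℕ) (y : Fin (n + 1) → (Fin n → Bool) → Bool) : Prop :=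
  ∃ s t : Fin n, t.val = s.val + 1 ∧ ∃ R : Finset (Fin (n + 1)), R.card ≤ K ∧
    ∃ m : ℕ, m ≤ K ∧ ∃ far : Fin m → Fin (n + 1),
    (∀ k, (far k).val + L ≤ t.val ∨ t.val + L ≤ (far k).val) ∧
    (∀ k k', k ≠ k' → (far k).val + L ≤ (far k').val ∨ (far k').val + L ≤ (far k).val) ∧
    L ≤ (Finset.univ.filter fun i : Fin n =>
      (i.val < t.val ∧ ∀ k, i.val < (far k).val) ∨ (t.val ≤ i.val ∧ ∀ k, (far k).val ≤ i.val)).card ∧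
    (∀ g ∈ R, (¬ ∃ k, far k = g) → t.val ≤ g.val + w ∧ g.val ≤ t.val + w) ∧
    (∀ g, g ∉ R → ∀ u : Fin n → Bool, u s ≠ u t → y g (SegMove.segCompl u s.val (s.val + 2)) = y g u) ∧
    2 ^ n ≤ 4 * p * (Finset.univ.filter fun u : Fin n → Bool => u s ≠ u t ∧
      (ringWinU 0 y (SegMove.segCompl u s.val (s.val + 2)) ≠ ringWinU 0 y u ∨
        ringWinU 1 y (SegMove.segCompl u s.val (s.val + 2)) ≠ ringWinU 1 y u ∨
          ringWinU 2 y (SegMove.segCompl u s.val (s.val + 2)) ≠ ringWinU 2 y u)).card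

end Summit.QuantumAdvantage.AdviceFreeQNC0.JLinPeel.TowerDefs

namespace Summit.QuantumAdvantage.AdviceFreeQNC0.JLinPeel.TokenDial

open SegMove

variable {n : ℕ}

section SepDial

variable {p : ℕ} [hp : Fact p.Prime]

omit hp in
/-- ★ the metric form gives the far dial's hypothesis. -/
theorem farFlipHyp_of_sepFlipHyp {K w L : ℕ} {y : Fin (n + 1) → (Fin n → Bool) → Bool}
    (h : TowerDefs.SepFlipHyp p K w L y) : TowerDefs.FarFlipHyp p K w L y := by
  obtain ⟨s, t, hst, R, hR, m, hm, far, hsepT, hsep, hout, hnear, hstab, hrich⟩ := h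
  exact ⟨s, t, hst, R, hR, m, hm, far, indepRows_of_separated t far L hsepT hsep hout, hnear, hstab, hrich⟩

/-- ★ **THE SEPARATED-READER FLIP DIAL AT LOG BUDGET.** for every prime `p ≠ 3`, eventually in `n`: a `log₂ n`-junta ⊕ form presentation
whose strategy meets `SepFlipHyp p (dialB n) (dialB n) (farL n)` wins on at most `(1 − 1/(48p))·2ⁿ` inputs, for every residue `c`. -/
theorem sepFlip_hard_log (hp3 : p ≠ 3) : ∃ n₀ : ℕ, ∀ n ≥ n₀, ∀ (c : ℕ) (D : JLinPeel.JLinData p n),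
    (∀ g, (D.J g).card ≤ Nat.log 2 n) →
      TowerDefs.SepFlipHyp p (TowerDefs.dialB n) (TowerDefs.dialB n) (TowerDefs.farL n) D.strat →
      ((univ.filter fun u : Fin n → Bool => ringWinU c D.strat u = true).card : ℝ)
        ≤ (1 - 1 / (48 * p)) * (2 : ℝ) ^ n := by
  obtain ⟨n₀, hn₀⟩ := farFlip_hard_log (p := p) hp3
  exact ⟨n₀, fun n hn c D hJ hT => hn₀ n hn c D hJ (farFlipHyp_of_sepFlipHyp hT)⟩

end SepDial


end Summit.QuantumAdvantage.AdviceFreeQNC0.JLinPeel.TokenDial
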